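import Summits.QuantumFields.YangMills.Theorems.BalabanLadderNTMarkovMirrorBare
import Literature.MathematicalPhysics.QuantumLattice.LatticeGaugeDLRGibbsProofs
import Literature.Probability.LatticeModels.GibbsExistenceCompact
import HarnessLib

/-!
# Crux `NT` / seam `UVSeamRec.stub_floorsEngine` (S-B): the PINNED classical collar functional of the Markov–mirror
# method lanes (owner RULING R87 (2) «definition request D1», cards `markov-mirror-dirichlet-response` /
# `moderate-deviation-event-witness`)

Definition helper file (`--supports stmt-QuantumFields-20043`; owner RULINGS R78/R87) of the fleet lead
`ym-spine-19353-p1`, typing in the tree the object asked for by RULING R87 (2): «the v-weighted classical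
Dirichlet-excess / last-scale coarse-field functional on the closed collar, typed over existing decls with the
admissibility lemmas continuous / bounded cylinder / window» — the PIN that turns the withdrawn unpinned shell data
`∃ 𝒢` of the Markov–mirror package ({RBL+SUP, SF}, costume by R87 (1)) into a statement with independent content
(method lanes (M-F) card F, card E's RBL-pinned).  Kernel-checked from the crux-ideate sketch `SketchG` §D
(`ym-cruxidea-19353-1` g7, rc 0) in tree vocabulary.

WHICH CLAUSE IT SERVES: conjunct 2 (two-point floor) of the REGISTERED `UVSeamRec.stub_floorsEngine` — the shell
functional `𝒢_β` of `MarkovMirrorFloors.stubFloorsEngine_of_mirrorPackage_rF` (p512282) / the statistic `h_β` of card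
F's event-witness package, PINNED.

* `classSup β t Q W η = sup_u [−β·S_Q(u ∨_Q η) + t·W(u ∨_Q η)]` over interior configurations `u` of the cube
  `Q = (c, b)` glued into the exterior `η` (tree `glueWith`, `wilsonBoundaryAction`);
* `dirichletResponse β t Q W := classSup β t Q W − classSup β 0 Q W` — the TILTED CLASSICAL DIRICHLET RESPONSE of
  the cube to the insertion `W` (selection-free: no minimiser is chosen).  Semiclassically (`β → ∞`, `t = β·s`):
  `dirichletResponse/β → s·W(ū(η)) + O(s²)` at a non-degenerate minimiser `ū(η)` — the classical one-point response,
  the leading term of `kerE_Q^η(W) − p(β)` in card E's (RBL);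
* admissibility in the package currency: `continuous_dirichletResponse` (Mathlib `IsCompact.continuous_sSup`),
  `abs_dirichletResponse_le` (`≤ |t|·MW`), `isCylinder_dirichletResponse` (support `supp W ∪ collar(Q)` = the support
  of `kerE_Q(W)`), `dirichletResponse_window` (= `MarkovMirror.kerE_supp_window`).

HONEST FRAMING.  Definitions + admissibility only; no response law (RBL-pinned), no floor, nothing about NT, the seam
or a mass gap is asserted. [cite: GlimmJaffe1987, §6.1]
-/

set_option autoImplicit false

noncomputable section

open MeasureTheory Filter Topology
open Literature.MathematicalPhysics.QuantumFieldTheory Literature.MathematicalPhysics.QuantumLattice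
open Literature.Probability.LatticeModels
open Summit.QuantumFields.YangMills.Cruxes.OSLegsFromFemtoAndGap.DlrCollarTransfer

namespace Summit.QuantumFields.YangMills.Cruxes.NT.DirichletResponse

variable (G : Type) [Group G] [TopologicalSpace G] [IsTopologicalGroup G] [CompactSpace G]
  [MeasurableSpace G] [BorelSpace G] (r : LatticeRep G)

/-- **The tilted classical energy supremum** of the cube `(c, b)` with exterior `η`:
`sup_u [−β·S_Q(u ∨_Q η) + t·W(u ∨_Q η)]` over interior link configurations `u` glued into `η`. -/
def classSup (β t : ℝ) (c : Fin 4 → ℤ) (b : ℕ) (W : LGConfig 4 G → ℝ) (η : LGConfig 4 G) : ℝ :=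
  sSup ((fun u : ↥(cubeEdges c b) → G =>
      -β * wilsonBoundaryAction r.ρ (cubeEdges c b) (glueWith (cubeEdges c b) u η) +
        t * W (glueWith (cubeEdges c b) u η)) '' Set.univ)

/-- **The tilted classical Dirichlet response** (the PIN of cards E/F, owner R87 (2)): `classSup β t − classSup β 0` —
the excess of the tilted classical Dirichlet energy of the cube over the untilted one, as a functional of the exterior. -/
def dirichletResponse (β t : ℝ) (c : Fin 4 → ℤ) (b : ℕ) (W : LGConfig 4 G → ℝ) (η : LGConfig 4 G) : ℝ :=
  classSup G r β t c b W η - classSup G r β 0 c b W η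

omit [MeasurableSpace G] [BorelSpace G] [CompactSpace G] in
/-- The tilted classical energy of the cube is jointly continuous in (exterior, interior). [folklore] -/
theorem continuous_tiltedEnergy (β t : ℝ) (c : Fin 4 → ℤ) (b : ℕ) {W : LGConfig 4 G → ℝ} (hW : Continuous W) :
    Continuous fun p : LGConfig 4 G × (↥(cubeEdges c b) → G) =>
      -β * wilsonBoundaryAction r.ρ (cubeEdges c b) (glueWith (cubeEdges c b) p.2 p.1) +
        t * W (glueWith (cubeEdges c b) p.2 p.1) := by
  have hg := continuous_glueWith_prod (G := G) (cubeEdges c b)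
  exact (continuous_const.mul ((continuous_wilsonBoundaryAction r.ρ r.continuous _).comp hg)).add
    (continuous_const.mul (hW.comp hg))

omit [MeasurableSpace G] [BorelSpace G] in
/-- `classSup` is continuous in the exterior field (supremum over a compact fibre of a jointly continuous function:
Mathlib `IsCompact.continuous_sSup`). [folklore] -/
theorem continuous_classSup (β t : ℝ) (c : Fin 4 → ℤ) (b : ℕ) {W : LGConfig 4 G → ℝ} (hW : Continuous W) :
    Continuous (classSup G r β t c b W) := by
  unfold classSup
  exact isCompact_univ.continuous_sSup (continuous_tiltedEnergy G r β t c b hW)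

omit [MeasurableSpace G] [BorelSpace G] in
/-- **Continuity of the pin**: `dirichletResponse β t Q W` is continuous in the exterior field. [folklore] -/
theorem continuous_dirichletResponse (β t : ℝ) (c : Fin 4 → ℤ) (b : ℕ) {W : LGConfig 4 G → ℝ}
    (hW : Continuous W) : Continuous (dirichletResponse G r β t c b W) :=
  (continuous_classSup G r β t c b hW).sub (continuous_classSup G r β 0 c b hW)

/-- Sup comparison on a compact space: uniformly close continuous functions have close suprema. [folklore] -/
theorem abs_sSup_image_sub_le {X : Type*} [TopologicalSpace X] [CompactSpace X] [Nonempty X] {F₁ F₂ : X → ℝ}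
    (h₁ : Continuous F₁) (h₂ : Continuous F₂) {D : ℝ} (hD : ∀ u, |F₁ u - F₂ u| ≤ D) :
    |sSup (F₁ '' Set.univ) - sSup (F₂ '' Set.univ)| ≤ D := by
  have hb₁ : BddAbove (F₁ '' Set.univ) := isCompact_univ.bddAbove_image h₁.continuousOn
  have hb₂ : BddAbove (F₂ '' Set.univ) := isCompact_univ.bddAbove_image h₂.continuousOn
  have hne₁ : (F₁ '' Set.univ).Nonempty := Set.univ_nonempty.image F₁
  have hne₂ : (F₂ '' Set.univ).Nonempty := Set.univ_nonempty.image F₂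
  rw [abs_sub_le_iff]
  constructor
  · rw [sub_le_iff_le_add]
    refine csSup_le hne₁ ?_
    rintro _ ⟨u, -, rfl⟩
    have h := (abs_sub_le_iff.1 (hD u)).1
    have h' : F₂ u ≤ sSup (F₂ '' Set.univ) := le_csSup hb₂ (Set.mem_image_of_mem F₂ (Set.mem_univ u))
    linarith
  · rw [sub_le_iff_le_add]
    refine csSup_le hne₂ ?_
    rintro _ ⟨u, -, rfl⟩
    have h := (abs_sub_le_iff.1 (hD u)).2
    have h' : F₁ u ≤ sSup (F₁ '' Set.univ) := le_csSup hb₁ (Set.mem_image_of_mem F₁ (Set.mem_univ u))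
    linarith

omit [MeasurableSpace G] [BorelSpace G] in
/-- **Boundedness of the pin**: `|dirichletResponse β t Q W η| ≤ |t|·MW` for `|W| ≤ MW`. [folklore] -/
theorem abs_dirichletResponse_le (β t : ℝ) (c : Fin 4 → ℤ) (b : ℕ) {W : LGConfig 4 G → ℝ} (hW : Continuous W)
    {MW : ℝ} (hMW : ∀ U, |W U| ≤ MW) (η : LGConfig 4 G) : |dirichletResponse G r β t c b W η| ≤ |t| * MW := by
  unfold dirichletResponse classSup
  have hc : ∀ s : ℝ, Continuous fun u : ↥(cubeEdges c b) → G =>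
      -β * wilsonBoundaryAction r.ρ (cubeEdges c b) (glueWith (cubeEdges c b) u η) +
        s * W (glueWith (cubeEdges c b) u η) := fun s => by
    have hg := continuous_glueWith_left (cubeEdges c b) η
    exact (continuous_const.mul ((continuous_wilsonBoundaryAction r.ρ r.continuous _).comp hg)).add
      (continuous_const.mul (hW.comp hg))
  refine abs_sSup_image_sub_le (hc t) (hc 0) fun u => ?_
  have e : -β * wilsonBoundaryAction r.ρ (cubeEdges c b) (glueWith (cubeEdges c b) u η) +
        t * W (glueWith (cubeEdges c b) u η) -
      (-β * wilsonBoundaryAction r.ρ (cubeEdges c b) (glueWith (cubeEdges c b) u η) +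
        0 * W (glueWith (cubeEdges c b) u η)) = t * W (glueWith (cubeEdges c b) u η) := by ring
  rw [e, abs_mul]
  exact mul_le_mul_of_nonneg_left (hMW _) (abs_nonneg t)

omit [MeasurableSpace G] [BorelSpace G] [IsTopologicalGroup G] [CompactSpace G] in
/-- `classSup` reads only the links of `supp W ∪ collar(Q)` of the exterior. [folklore] -/
theorem classSup_congr (β t : ℝ) (c : Fin 4 → ℤ) (b : ℕ) {W : LGConfig 4 G → ℝ}
    {S : Finset (Literature.MathematicalPhysics.QuantumLattice.ZdEdge 4)} (hWS : IsCylinder W S)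
    {η η' : LGConfig 4 G}
    (h : ∀ e ∈ (↑(S ∪ (plaquettesTouching (cubeEdges c b)).biUnion plaquetteEdges) :
      Set (Literature.MathematicalPhysics.QuantumLattice.ZdEdge 4)), η e = η' e) :
    classSup G r β t c b W η = classSup G r β t c b W η' := by
  have hglue : ∀ (u : ↥(cubeEdges c b) → G) (e : Literature.MathematicalPhysics.QuantumLattice.ZdEdge 4),
      e ∈ S ∪ (plaquettesTouching (cubeEdges c b)).biUnion plaquetteEdges →
        glueWith (cubeEdges c b) u η e = glueWith (cubeEdges c b) u η' e := by
    intro u e he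
    by_cases hm : e ∈ cubeEdges c b
    · rw [glueWith_apply_mem _ _ _ hm, glueWith_apply_mem _ _ _ hm]
    · rw [glueWith_apply_not_mem _ _ _ hm, glueWith_apply_not_mem _ _ _ hm]
      exact h e (Finset.mem_coe.2 he)
  have hfun : (fun u : ↥(cubeEdges c b) → G =>
        -β * wilsonBoundaryAction r.ρ (cubeEdges c b) (glueWith (cubeEdges c b) u η) +
          t * W (glueWith (cubeEdges c b) u η)) =
      fun u => -β * wilsonBoundaryAction r.ρ (cubeEdges c b) (glueWith (cubeEdges c b) u η') +
          t * W (glueWith (cubeEdges c b) u η') := by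
    funext u
    have hS : wilsonBoundaryAction r.ρ (cubeEdges c b) (glueWith (cubeEdges c b) u η) =
        wilsonBoundaryAction r.ρ (cubeEdges c b) (glueWith (cubeEdges c b) u η') :=
      isCylinder_wilsonBoundaryAction_holds r.ρ (cubeEdges c b)
        (fun e he => hglue u e (Finset.mem_union_right _ (Finset.mem_coe.1 he)))
    have hW' : W (glueWith (cubeEdges c b) u η) = W (glueWith (cubeEdges c b) u η') :=
      hWS (fun e he => hglue u e (Finset.mem_union_left _ (Finset.mem_coe.1 he)))
    rw [hS, hW']
  unfold classSup
  rw [hfun]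

omit [MeasurableSpace G] [BorelSpace G] [IsTopologicalGroup G] [CompactSpace G] in
/-- **Cylinder support of the pin**: `dirichletResponse β t Q W` is a cylinder function of the links
`supp W ∪ collar(Q)` — the same support as `kerE_Q(W)` (`MarkovMirror.isCylinder_kerE`). [folklore] -/
theorem isCylinder_dirichletResponse (β t : ℝ) (c : Fin 4 → ℤ) (b : ℕ) {W : LGConfig 4 G → ℝ}
    {S : Finset (Literature.MathematicalPhysics.QuantumLattice.ZdEdge 4)} (hWS : IsCylinder W S) :
    IsCylinder (dirichletResponse G r β t c b W)
      (S ∪ (plaquettesTouching (cubeEdges c b)).biUnion plaquetteEdges) := by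
  intro η η' h
  show classSup G r β t c b W η - classSup G r β 0 c b W η = classSup G r β t c b W η' - classSup G r β 0 c b W η'
  rw [classSup_congr G r β t c b hWS h, classSup_congr G r β 0 c b hWS h]

omit [MeasurableSpace G] [BorelSpace G] [IsTopologicalGroup G] [CompactSpace G] [TopologicalSpace G] [Group G] in
/-- **Window of the pin** (= `MarkovMirror.kerE_supp_window`): if `W`'s links are based in the box `[c, c+b]` and
the cube sits at positive time `c 0 ≥ 1`, every link read by the pin is based at times in `[0, c 0 + b + 1]`. [folklore] -/
theorem dirichletResponse_window {c : Fin 4 → ℤ} {b : ℕ} (hc : 1 ≤ c 0)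
    {S : Finset (Literature.MathematicalPhysics.QuantumLattice.ZdEdge 4)}
    (hS : ∀ e ∈ S, ∀ j, c j ≤ e.1 j ∧ e.1 j ≤ c j + b)
    {e : Literature.MathematicalPhysics.QuantumLattice.ZdEdge 4}
    (he : e ∈ S ∪ (plaquettesTouching (cubeEdges c b)).biUnion plaquetteEdges) :
    0 ≤ e.1 0 ∧ e.1 0 ≤ c 0 + b + 1 := by
  have h := MarkovMirror.kerE_supp_window hS he 0
  constructor <;> linarith [h.1, h.2]

/-- **Admissibility package of the pin for the cube-carried smeared density** (the shape the Markov–mirror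
press-buttons ask of a shell functional / witness): for the cube `Q = (c, b)` at positive time `c 0 ≥ 1` and
`Ṽ = ∑_{y ∈ Q} w(y)·dens_y`, the pin `dirichletResponse β t Q Ṽ` is continuous, bounded by `|t|·sup|Ṽ|`, and a cylinder
function of links based at times in `[0, c 0 + b + 1]`. [folklore] -/
theorem dirichletResponse_cubeSmear_admissible (β t : ℝ) (c : Fin 4 → ℤ) (b : ℕ) (hc : 1 ≤ c 0)
    (w : (Fin 4 → ℤ) → ℝ) :
    Continuous (dirichletResponse G r β t c b (fun V => ∑ y ∈ cubeSites c b, w y * dens G r y V)) ∧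
    (∃ K : ℝ, ∀ η, |dirichletResponse G r β t c b (fun V => ∑ y ∈ cubeSites c b, w y * dens G r y V) η| ≤ K) ∧
    ∃ S : Finset (Literature.MathematicalPhysics.QuantumLattice.ZdEdge 4),
      IsCylinder (dirichletResponse G r β t c b (fun V => ∑ y ∈ cubeSites c b, w y * dens G r y V)) S ∧
      ∀ e ∈ S, 0 ≤ e.1 0 ∧ e.1 0 ≤ c 0 + b + 1 := by
  have hWc := MarkovMirror.continuous_cubeSmear G r c b w
  obtain ⟨MW, hMW⟩ := MarkovMirror.exists_abs_cubeSmear_le G r c b w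
  obtain ⟨SW, hWS, hSW⟩ := MarkovMirror.exists_isCylinder_cubeSmear G r c b w
  refine ⟨continuous_dirichletResponse G r β t c b hWc,
    ⟨|t| * MW, fun η => abs_dirichletResponse_le G r β t c b hWc hMW η⟩,
    SW ∪ (plaquettesTouching (cubeEdges c b)).biUnion plaquetteEdges,
    isCylinder_dirichletResponse G r β t c b hWS, fun e he => dirichletResponse_window hc hSW he⟩

end Summit.QuantumFields.YangMills.Cruxes.NT.DirichletResponse

end
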